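import Literature.Analysis.FluidPDE.FluidComputer.ThresholdLevelTableU
import HarnessLib

/-!
# Kernel run of the re-cut table over the 10⁻² box, chunks 36 … 39 (bp3 gen 13, layer 4: robustness variant U)

HONEST FRAMING: low prior, high value-of-information experiment on Tao's machine paradigm; NOT a
claim that NS blows up.

Four kernel evaluations (`decide +kernel`; no `native_decide`, no extra axioms) of the checker
`runSteps` (`ThresholdLevelCheck.lean`) with the interval gate data `GIu` (all seven data within
relative `10⁻²`) on ≤ 25 steps of `ThresholdLevelTableU.stepsU` at a time, from `Bu i` towards the next chunk's
first level, returning `Bu (i+1)` (`Bu 0 = ThresholdLevelTable.Bc0`).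
-/

namespace Literature.Analysis.FluidPDE.FluidComputer

namespace ThresholdLevelTableU

open ThresholdLevelTable (Bc0 RbIt)

set_option maxHeartbeats 10000000 in
set_option maxRecDepth 200000 in
/-- Chunk 36 of the re-cut table run over the 10⁻² box (steps 900 … 924). [folklore] -/
theorem runU36 : runSteps 60 12 3 GIu RbIt Bu36 chunkU36 11789855660455124 = some Bu37 := by
  decide +kernel

set_option maxHeartbeats 10000000 in
set_option maxRecDepth 200000 in
/-- Chunk 37 of the re-cut table run over the 10⁻² box (steps 925 … 949). [folklore] -/
theorem runU37 : runSteps 60 12 3 GIu RbIt Bu37 chunkU37 12862021020692962 = some Bu38 := by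
  decide +kernel

set_option maxHeartbeats 10000000 in
set_option maxRecDepth 200000 in
/-- Chunk 38 of the re-cut table run over the 10⁻² box (steps 950 … 974). [folklore] -/
theorem runU38 : runSteps 60 12 3 GIu RbIt Bu38 chunkU38 14031858832358526 = some Bu39 := by
  decide +kernel

set_option maxHeartbeats 10000000 in
set_option maxRecDepth 200000 in
/-- Chunk 39 of the re-cut table run over the 10⁻² box (steps 975 … 999). [folklore] -/
theorem runU39 : runSteps 60 12 3 GIu RbIt Bu39 chunkU39 15307911178806116 = some Bu40 := by
  decide +kernel

end ThresholdLevelTableU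

end Literature.Analysis.FluidPDE.FluidComputer
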